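import Summits.AtomisticToContinuum.HydrodynamicLimit.Theorems.CollisionIsometryCLTMacroClosureEngineBlockClosure
import Summits.AtomisticToContinuum.HydrodynamicLimit.Theorems.CollisionIsometryCLTMacroClosureEngineRelFlux
import Summits.AtomisticToContinuum.HydrodynamicLimit.Theorems.CollisionIsometryCLTMacroClosureEngineHotCells
import Summits.AtomisticToContinuum.HydrodynamicLimit.Theorems.CollisionIsometryCLTMacroClosureEngineIsentropic
import Summits.AtomisticToContinuum.HydrodynamicLimit.Theorems.CollisionIsometryCLTMacroClosureStubClausiusCore
import Summits.AtomisticToContinuum.HydrodynamicLimit.Theorems.CollisionIsometryCLTMacroClosureStubClausiusLimits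
import HarnessLib

/-!
# Sub-goal `engine_productionBound` of the lead's `engine_incrementBound` (line `IdeatorTwoGen1Sketch`,
# crux `MacroClosure`, stmt-AtomisticToContinuum-14870): the relative-flux race at a fixed time

For a classical hs-Euler solution `(ρ, u, θ)` on `[0, T)` in the dilute chamber of `ThermoChamber η₃`,
`0 < t < T`, a band floor `c₁ > 0` (`c₁σ³ ≤ 1`) and `λ > 0` there is ONE `K ≥ 0` such that for all
`M ≥ 1`, every smooth kernel `φ ≥ 0` of unit mass, every configuration `w` whose blocks lie in the band
`c₁ ≤ ρ̄ ≤ σ⁻³` with the strict kinetic inequality `|m̄|² < 2ρ̄Ē`, and every `τ ∈ [0, t]`: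
`x ↦ h_σ(Ū(w,x) | U_cl(τ,x))` is continuous and non-negative, and

`prodCl(τ) − prodBlock(τ, w) ≤ K √M ∫ₓ h_σ(Ū | U_cl(τ)) + K √M e^{−λM/4} ⟨emp w, e^{λ|v|²}⟩`.

Proof. (0) The classical states `U_cl([0,t] × 𝕋³)` form a compact part `K_c` of the (open) chamber
(continuous image of `[0,t] × [0,1]³` under the space–time lift). (1) By the compatibility identity of
clause 3 of `ThermoChamber` (`engine_compat`), pointwise in `x`,
`block density − classical density = Σⱼ ∂ⱼΛ(τ,x)·Rⱼ(Ū(x) | U_cl(τ,x))` with the flux Taylor remainders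
`Rⱼ = fluxRem`; both production densities are integrable in `x` (the classical one is continuous; the
block one is `∂τΛ·Ū` (continuous) plus `Σⱼ ∂ⱼΛ·Fⱼ(Ū)` with `Fⱼ(Ū)` integrable on the band — the block
pressure is integrable by Ruelle convexity, `EngineBlockClosure.integrable_pressure`). (2) `‖∂ⱼΛ‖ ≤ L`
on `[0,t] × 𝕋³` (joint smoothness of `Λ`), so `prodCl − prodBlock = −∫ₓ Σⱼ ∂ⱼΛ·Rⱼ ≤ L ∫ₓ Σⱼ ‖Rⱼ‖`.
(3) On the blocks that are not hot (`Ē ≤ Mρ̄`) `‖Rⱼ‖ ≤ C_r √M h_σ(Ū | U_cl)` and on the hot blocks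
`‖Rⱼ‖ ≤ C_r (ρ̄ + |m̄| + Ē + Ē√(Ē/ρ̄))` (`engine_relFlux` on `K_c`); `h_σ ≥ 0` everywhere by the
coercivity of clause 2 on `K_c`, and the hot blocks carry at most `C_h √M e^{−λM/4} ⟨emp w, e^{λ|v|²}⟩`
(`engine_hotCells`). Hence the claim with `K = 3 L C_r (1 + C_h)`. Continuity of the relative entropy
density: `η_σ ∘ Ū` is continuous on band configurations with positive block temperature
(`Clausius.continuous_hsEntropy_bU`, `f_ex` being continuous on the band by Ruelle convexity), and
`η_σ ∘ U_cl`, `Λ = Dη_σ ∘ U_cl`, `U_cl` are continuous time slices of jointly smooth fields.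
-/

noncomputable section

open MeasureTheory Filter Set Topology InformationTheory
open scoped ENNReal ContDiff

namespace Summit.AtomisticToContinuum.HydrodynamicLimit.Theorems.MacroClosureLine

open Literature.MathematicalPhysics.KineticTheory Literature.Analysis.FluidPDE
open Literature.Analysis.FunctionSpaces
open Summit.AtomisticToContinuum.HydrodynamicLimit.Theses

namespace Barycentric

namespace EngineProductionBound

variable {n : ℕ}

/-- A continuous operator field on `𝕋³` applied to an integrable vector field is integrable
(`‖L(x)G(x)‖ ≤ (sup ‖L‖) ‖G(x)‖`). -/
theorem integrable_clm_apply {E' : Type*} [NormedAddCommGroup E'] [NormedSpace ℝ E']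
    {L : T3 → (E' →L[ℝ] ℝ)} {G : T3 → E'} (hL : Continuous L) (hG : Integrable G) :
    Integrable (fun x => L x (G x)) := by
  obtain ⟨C, hC⟩ := isCompact_univ.exists_bound_of_continuousOn hL.continuousOn
  refine Integrable.mono' (hG.norm.const_mul C) ?_ (ae_of_all _ fun x => ?_)
  · exact (show Continuous fun p : (E' →L[ℝ] ℝ) × E' => p.1 p.2 from
      isBoundedBilinearMap_apply.continuous).comp_aestronglyMeasurable₂ hL.aestronglyMeasurable
        hG.aestronglyMeasurable
  · exact (L x).le_of_opNorm_le (hC x (mem_univ x)) (G x)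

/-- **The hs-Euler fluxes of the block state are integrable on a band configuration**:
`Fⱼ(Ū) = (m̄ⱼ, (m̄ⱼ/ρ̄) m̄ + p̄ eⱼ, (Ē + p̄) m̄ⱼ/ρ̄)` with `ρ̄ ≥ c₁ > 0`, continuous block fields and the
block pressure `p̄ = hsPressure σ ρ̄ θ̄` integrable by Ruelle convexity (`HsFreeEnergyConvex`). -/
theorem integrable_flux_bU (hH : StiffCollisionalRelaxation.HsFreeEnergyConvex) {σ c₁ : ℝ}
    (hσ : 0 < σ) (hc₁ : 0 < c₁) {φ : T3 → ℝ} (hφc : Continuous φ) (w : Config (n + 1) (Fin 3) T3)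
    (hband : ∀ x, c₁ ≤ bρ φ w x ∧ bρ φ w x * σ ^ 3 ≤ 1) (j : Fin 3) :
    Integrable (fun x => eulerFlux σ j (bU φ w x)) := by
  have hρc := Clausius.continuous_bρ hφc w
  have hmc := Clausius.continuous_bm hφc w
  have hEc := Clausius.continuous_bE hφc w
  have hρ0 : ∀ x, bρ φ w x ≠ 0 := fun x => (hc₁.trans_le (hband x).1).ne'
  obtain ⟨-, -, hmj, hθc, -⟩ := EngineBlockClosure.continuous_blocks hφc w hρ0
  have hp := EngineBlockClosure.integrable_pressure hH hσ hc₁ hφc w hband hθc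
  have hq : Continuous fun x => bm φ w x j / bρ φ w x := (hmj j).div hρc hρ0
  obtain ⟨C, -, hC⟩ := exists_forall_abs_le_of_continuous hq
  have i1 : Integrable (fun x => bm φ w x j) := integrable_of_continuous_T3 (hmj j)
  have i2 : Integrable (fun x => (bm φ w x j / bρ φ w x) • bm φ w x +
      hsPressure σ (bρ φ w x) (bθ φ w x) • EuclideanSpace.single j (1 : ℝ)) :=
    (integrable_of_continuous_T3 (hq.smul hmc)).add (hp.smul_const _)
  have i3 : Integrable (fun x =>
      (bE φ w x + hsPressure σ (bρ φ w x) (bθ φ w x)) * bm φ w x j / bρ φ w x) := by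
    have hEp : Integrable (fun x => bE φ w x + hsPressure σ (bρ φ w x) (bθ φ w x)) :=
      (integrable_of_continuous_T3 hEc).add hp
    have h := hEp.mul_bdd hq.aestronglyMeasurable
      (ae_of_all _ fun x => show ‖bm φ w x j / bρ φ w x‖ ≤ C by
        rw [Real.norm_eq_abs]; exact hC x)
    simpa only [mul_div_assoc] using h
  have e : (fun x => eulerFlux σ j (bU φ w x)) = fun x => (bm φ w x j,
      (bm φ w x j / bρ φ w x) • bm φ w x +
        hsPressure σ (bρ φ w x) (bθ φ w x) • EuclideanSpace.single j (1 : ℝ),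
      (bE φ w x + hsPressure σ (bρ φ w x) (bθ φ w x)) * bm φ w x j / bρ φ w x) := rfl
  rw [e]
  exact i1.prodMk (i2.prodMk i3)

section Solution

variable {σ η₃ T : ℝ} {ρ θ : ℝ → T3 → ℝ} {u : ℝ → T3 → V3}

/-- **The block production density is integrable** (for `s ∈ [0, T)`, on a band configuration):
`∂ₛΛ(s,x)·Ū(x)` is continuous and `∂ⱼΛ(s,·)` is a continuous operator field applied to the integrable
`Fⱼ(Ū(·))`. -/
theorem integrable_prodBlock_integrand (hH : StiffCollisionalRelaxation.HsFreeEnergyConvex)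
    (hσ : 0 < σ) (hE : IsHardSphereEulerSolution σ T ρ u θ) (hT : ThermoChamber η₃)
    (hpack : ∀ s ∈ Ico 0 T, ∀ x, ρ s x * σ ^ 3 < η₃) {s : ℝ} (hs : s ∈ Ico 0 T) {c₁ : ℝ}
    (hc₁ : 0 < c₁) {φ : T3 → ℝ} (hφc : Continuous φ) (w : Config (n + 1) (Fin 3) T3)
    (hband : ∀ x, c₁ ≤ bρ φ w x ∧ bρ φ w x * σ ^ 3 ≤ 1) :
    Integrable (fun x => Torus.timeDerivWithin (Ico 0 T) (Lcl σ ρ θ u) s x (bU φ w x) +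
      ∑ j, Torus.partialDeriv j (Lcl σ ρ θ u s) x (eulerFlux σ j (bU φ w x))) := by
  obtain ⟨hΛ, -⟩ := EngineBlockClosure.lam_smooth hσ hE hT hpack
  have hU : UniqueDiffOn ℝ (Ico (0 : ℝ) T) := uniqueDiffOn_Ico 0 T
  have hLc : Continuous fun x => Torus.timeDerivWithin (Ico 0 T) (Lcl σ ρ θ u) s x :=
    ((hΛ.timeDerivWithin hU).isSmooth_slice hs).continuous
  have hLxc : ∀ j, Continuous fun x => Torus.partialDeriv j (Lcl σ ρ θ u s) x := fun j =>
    ((hΛ.partialDeriv hU j).isSmooth_slice hs).continuous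
  have hbU : Continuous fun x => bU φ w x :=
    (Clausius.continuous_bρ hφc w).prodMk
      ((Clausius.continuous_bm hφc w).prodMk (Clausius.continuous_bE hφc w))
  exact (integrable_of_continuous_T3 (hLc.clm_apply hbU)).add (integrable_finsetSum _ fun j _ =>
    integrable_clm_apply (hLxc j) (integrable_flux_bU hH hσ hc₁ hφc w hband j))

/-- **The classical production density is continuous** (for `s ∈ [0, T)`): time slices of the jointly
smooth `∂ₛΛ`, `∂ⱼΛ`, `U_cl`, `Fⱼ ∘ U_cl`. -/
theorem continuous_prodCl_integrand (hσ : 0 < σ) (hE : IsHardSphereEulerSolution σ T ρ u θ)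
    (hT : ThermoChamber η₃) (hpack : ∀ s ∈ Ico 0 T, ∀ x, ρ s x * σ ^ 3 < η₃) {s : ℝ}
    (hs : s ∈ Ico 0 T) :
    Continuous (fun x => Torus.timeDerivWithin (Ico 0 T) (Lcl σ ρ θ u) s x (Ucl ρ θ u s x) +
      ∑ j, Torus.partialDeriv j (Lcl σ ρ θ u s) x (eulerFlux σ j (Ucl ρ θ u s x))) := by
  obtain ⟨hΛ, -⟩ := EngineBlockClosure.lam_smooth hσ hE hT hpack
  have hU : UniqueDiffOn ℝ (Ico (0 : ℝ) T) := uniqueDiffOn_Ico 0 T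
  have hLc : Continuous fun x => Torus.timeDerivWithin (Ico 0 T) (Lcl σ ρ θ u) s x :=
    ((hΛ.timeDerivWithin hU).isSmooth_slice hs).continuous
  have hLxc : ∀ j, Continuous fun x => Torus.partialDeriv j (Lcl σ ρ θ u s) x := fun j =>
    ((hΛ.partialDeriv hU j).isSmooth_slice hs).continuous
  have hUc : Continuous fun x => Ucl ρ θ u s x :=
    ((isSmoothSpaceTimeOn_stateOf hE).isSmooth_slice hs).continuous
  have hFc : ∀ j, Continuous fun x => eulerFlux σ j (Ucl ρ θ u s x) := fun j =>
    ((EngineIsentropic.isSmoothSpaceTimeOn_flux hσ hT hE hpack j).isSmooth_slice hs).continuous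
  exact (hLc.clm_apply hUc).add (continuous_finsetSum _ fun j _ => (hLxc j).clm_apply (hFc j))

/-- **The compact part of the chamber visited by the classical solution on `[0, t]`**, `t < T`:
a compact `K ⊆ chamber σ η₃` containing every `U_cl(s, x)`, `s ∈ [0, t]` (image of the compact
`[0, t] × [0, 1]³` under the continuous space–time lift of `U_cl`). -/
theorem exists_compact_states (hE : IsHardSphereEulerSolution σ T ρ u θ)
    (hpack : ∀ s ∈ Ico 0 T, ∀ x, ρ s x * σ ^ 3 < η₃) {t : ℝ} (htT : t < T) :
    ∃ K : Set State, IsCompact K ∧ K ⊆ chamber σ η₃ ∧ ∀ s ∈ Icc (0 : ℝ) t, ∀ x, Ucl ρ θ u s x ∈ K := by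
  have hKS : Icc (0 : ℝ) t ⊆ Ico 0 T := Icc_subset_Ico_right htT
  have hUcl : Torus.IsSmoothSpaceTimeOn (Ico 0 T) (Ucl ρ θ u) := isSmoothSpaceTimeOn_stateOf hE
  refine ⟨Torus.stLift (Ucl ρ θ u) '' (Icc 0 t ×ˢ
    ((WithLp.toLp 2) '' (Set.pi univ fun _ : Fin 3 => Icc (0 : ℝ) 1) : Set (EuclideanSpace ℝ (Fin 3)))),
    ?_, ?_, ?_⟩
  · exact (isCompact_Icc.prod Torus.isCompact_toLp_image_pi_Icc).image_of_continuousOn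
      (hUcl.continuousOn_stLift.mono (prod_mono hKS (subset_univ _)))
  · rintro _ ⟨p, hp, rfl⟩
    exact EngineIsentropic.mapsTo_stLift_Ucl hE hpack ⟨hKS (mem_prod.1 hp).1, mem_univ _⟩
  · intro s hs x
    exact ⟨(s, Torus.repr x), mk_mem_prod hs (Torus.repr_mem_toLp_image_pi_Icc x), by simp⟩

end Solution

/-- The final arithmetic of the race: `A X + B H ≤ K √M X + K √M e I` for
`A = 3 L C √M`, `B = 3 L C`, `H ≤ C_h √M e I`, `K = 3 L C (1 + C_h)`, everything non-negative. -/
theorem final_arith {L C Ch sM e I X H : ℝ} (hL : 0 ≤ L) (hC : 0 ≤ C) (hCh : 0 ≤ Ch) (hsM : 0 ≤ sM)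
    (he : 0 ≤ e) (hI : 0 ≤ I) (hX : 0 ≤ X) (hH : H ≤ Ch * sM * e * I) :
    3 * L * C * sM * X + 3 * L * C * H ≤
      3 * L * C * (1 + Ch) * sM * X + 3 * L * C * (1 + Ch) * sM * e * I := by
  have h1 : 3 * L * C * H ≤ 3 * L * C * (Ch * sM * e * I) :=
    mul_le_mul_of_nonneg_left hH (by positivity)
  have h2 : 0 ≤ 3 * L * C * Ch * sM * X := by positivity
  have h3 : 0 ≤ 3 * L * C * sM * e * I := by positivity
  nlinarith

end EngineProductionBound

open EngineProductionBound in
/-- **`engine_productionBound` (registered sub-goal S1 of the lead's `engine_incrementBound`): the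
relative-flux race at a fixed time, configuration by configuration.** For a classical solution in the
chamber of `ThermoChamber η₃`, `0 < t < T`, a band floor `c₁` and `λ > 0` there is one `K ≥ 0` with:
for all `M ≥ 1`, smooth kernels `φ ≥ 0` of unit mass, band configurations `w` with the strict kinetic
inequality and `τ ∈ [0, t]`, the relative entropy density `x ↦ h_σ(Ū(w,x) | U_cl(τ,x))` is continuous
and non-negative and
`prodCl(τ) − prodBlock(τ,w) ≤ K√M ∫ₓ h_σ(Ū | U_cl(τ)) + K√M e^{−λM/4} ⟨emp w, e^{λ|v|²}⟩`
(compatibility kills the linear part; Dafermos' relative-flux bound on the blocks that are not hot,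
coercivity, and the exponential smallness of the hot blocks). -/
theorem engine_productionBound : ∀ (σ : ℝ), 0 < σ → StiffCollisionalRelaxation.HsFreeEnergyConvex → ∀ (T : ℝ) (ρ θ : ℝ → T3 → ℝ) (u : ℝ → T3 → V3), IsHardSphereEulerSolution σ T ρ u θ → ∀ η₃ : ℝ, ThermoChamber η₃ → (∀ s ∈ Ico 0 T, ∀ x, ρ s x * σ ^ 3 < η₃) → ∀ t : ℝ, 0 < t → t < T → ∀ c₁ : ℝ, 0 < c₁ → c₁ * σ ^ 3 ≤ 1 → ∀ lam : ℝ, 0 < lam → ∃ K : ℝ, 0 ≤ K ∧ ∀ M : ℝ, 1 ≤ M → ∀ (n : ℕ) (φ : T3 → ℝ), Torus.IsSmooth φ → (∀ y, 0 ≤ φ y) → ∫ y, φ y = 1 → ∀ w : Config (n + 1) (Fin 3) T3, (∀ x, c₁ ≤ bρ φ w x ∧ bρ φ w x * σ ^ 3 ≤ 1) → (∀ x, ‖bm φ w x‖ ^ 2 < 2 * bρ φ w x * bE φ w x) → ∀ τ ∈ Icc 0 t, Continuous (fun x => relEnt σ (bU φ w x) (Ucl ρ θ u τ x)) ∧ (∀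 x, 0 ≤ relEnt σ (bU φ w x) (Ucl ρ θ u τ x)) ∧ prodCl σ T ρ θ u τ - prodBlock σ T ρ θ u φ τ w ≤ K * Real.sqrt M * (∫ x, relEnt σ (bU φ w x) (Ucl ρ θ u τ x)) + K * Real.sqrt M * Real.exp (-(lam * M / 4)) * ∫ y, Real.exp (lam * ‖y.2‖ ^ 2) ∂(empiricalMeasure w) := by
  intro σ hσ hH T ρ θ u hE η₃ hT hpack t _ht htT c₁ hc₁ hc₁σ lam hlam
  -- clause 3 of `ThermoChamber`: smoothness of `Λ` and the compatibility identity
  obtain ⟨-, -, hcompat, -⟩ := (hT σ hσ).2.2 T ρ θ u hE hpack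
  have hΛ : Torus.IsSmoothSpaceTimeOn (Ico 0 T) (Lcl σ ρ θ u) :=
    (EngineBlockClosure.lam_smooth hσ hE hT hpack).1
  have hU : UniqueDiffOn ℝ (Ico (0 : ℝ) T) := uniqueDiffOn_Ico 0 T
  have hKS : Icc (0 : ℝ) t ⊆ Ico 0 T := Icc_subset_Ico_right htT
  have hUcl : Torus.IsSmoothSpaceTimeOn (Ico 0 T) (Ucl ρ θ u) := isSmoothSpaceTimeOn_stateOf hE
  -- (0) the compact part of the chamber visited on `[0, t]`; coercivity and the two constants
  obtain ⟨Kc, hKc, hKsub, hmemK⟩ := exists_compact_states hE hpack htT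
  obtain ⟨m, hm, hcoer⟩ := (hT σ hσ).2.1 Kc hKc hKsub
  obtain ⟨Cr, hCr, hrelA, hrelB⟩ := engine_relFlux σ hσ hH η₃ hT Kc hKc hKsub c₁ hc₁ hc₁σ
  obtain ⟨Ch, hCh, hhot⟩ := engine_hotCells lam c₁ hlam hc₁
  -- uniform bound on `‖∂ⱼΛ(s, x)‖`, `s ∈ [0, t]`
  have hbd : ∀ j, ∃ C : ℝ, ∀ s ∈ Icc (0 : ℝ) t, ∀ x, ‖Torus.partialDeriv j (Lcl σ ρ θ u s) x‖ ≤ C :=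
    fun j => (hΛ.partialDeriv hU j).exists_norm_le_of_isCompact isCompact_Icc hKS
  choose C hC using hbd
  obtain ⟨Lb, hLb⟩ : ∃ Lb : ℝ, Lb = ∑ j, |C j| := ⟨_, rfl⟩
  have hLb0 : 0 ≤ Lb := by rw [hLb]; exact Finset.sum_nonneg fun _ _ => abs_nonneg _
  have hLe : ∀ j, ∀ s ∈ Icc (0 : ℝ) t, ∀ x, ‖Torus.partialDeriv j (Lcl σ ρ θ u s) x‖ ≤ Lb := by
    intro j s hs x
    calc ‖Torus.partialDeriv j (Lcl σ ρ θ u s) x‖ ≤ |C j| := (hC j s hs x).trans (le_abs_self _)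
      _ ≤ Lb := by
          rw [hLb]
          exact Finset.single_le_sum (f := fun j => |C j|) (fun _ _ => abs_nonneg _)
            (Finset.mem_univ j)
  -- continuity of `f_ex` on the band (Ruelle convexity)
  have hfex : ContinuousOn hsExcessFreeEnergy (Icc (c₁ * σ ^ 3) 1) :=
    (Clausius.continuousOn_hsExcessFreeEnergy hH).mono fun r hr =>
      ⟨(mul_pos hc₁ (pow_pos hσ 3)).trans_le hr.1, hr.2.trans_lt (by norm_num)⟩
  refine ⟨3 * Lb * Cr * (1 + Ch), by positivity, ?_⟩
  intro M hM n φ hφ hφ0 hφ1 w hband hkin τ hτ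
  have hτ' : τ ∈ Ico 0 T := hKS hτ
  have hφc : Continuous φ := hφ.continuous
  have hρc := Clausius.continuous_bρ hφc w
  have hmc := Clausius.continuous_bm hφc w
  have hEc := Clausius.continuous_bE hφc w
  have hρpos : ∀ x, 0 < bρ φ w x := fun x => hc₁.trans_le (hband x).1
  have hρ0 : ∀ x, bρ φ w x ≠ 0 := fun x => (hρpos x).ne'
  have hbU : Continuous fun x => bU φ w x := hρc.prodMk (hmc.prodMk hEc)
  -- (1) continuity and (2) non-negativity of the relative entropy density
  have hθpos : ∀ x, 0 < stateTemp (bU φ w x) := fun x =>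
    stateTemp_pos_of_mem (σ := σ) (η := 2)
      (show bU φ w x ∈ chamber σ 2 from ⟨hρpos x, (hband x).2.trans_lt (by norm_num), hkin x⟩)
  have hηV : Continuous fun x => hsEntropy σ (bU φ w x) :=
    Clausius.continuous_hsEntropy_bU hσ hc₁ hfex hφc w hband hθpos
  have hηU : Continuous fun x => hsEntropy σ (Ucl ρ θ u τ x) :=
    ((EngineIsentropic.isSmoothSpaceTimeOn_entropy hσ hT hE hpack).isSmooth_slice hτ').continuous
  have hUc : Continuous fun x => Ucl ρ θ u τ x := (hUcl.isSmooth_slice hτ').continuous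
  have hΛc : Continuous fun x => fderiv ℝ (hsEntropy σ) (Ucl ρ θ u τ x) :=
    (hΛ.isSmooth_slice hτ').continuous
  have hrel : Continuous fun x => relEnt σ (bU φ w x) (Ucl ρ θ u τ x) := by
    unfold relEnt
    exact (hηV.sub hηU).sub (hΛc.clm_apply (hbU.sub hUc))
  have hrel0 : ∀ x, 0 ≤ relEnt σ (bU φ w x) (Ucl ρ θ u τ x) := fun x =>
    (mul_nonneg hm.le (le_min (sq_nonneg _) (norm_nonneg _))).trans
      (hcoer _ (hmemK τ hτ x) (bU φ w x) (hρpos x) ((hband x).2.trans_lt (by norm_num)) (hkin x))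
  refine ⟨hrel, hrel0, ?_⟩
  -- (3) the production bound: the two densities and the compatibility identity
  obtain ⟨Ibl, hIbl⟩ : ∃ Ibl : T3 → ℝ, Ibl = fun x =>
      Torus.timeDerivWithin (Ico 0 T) (Lcl σ ρ θ u) τ x (bU φ w x) +
        ∑ j, Torus.partialDeriv j (Lcl σ ρ θ u τ) x (eulerFlux σ j (bU φ w x)) := ⟨_, rfl⟩
  obtain ⟨Icl, hIcl⟩ : ∃ Icl : T3 → ℝ, Icl = fun x =>
      Torus.timeDerivWithin (Ico 0 T) (Lcl σ ρ θ u) τ x (Ucl ρ θ u τ x) +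
        ∑ j, Torus.partialDeriv j (Lcl σ ρ θ u τ) x (eulerFlux σ j (Ucl ρ θ u τ x)) := ⟨_, rfl⟩
  have hIbl_int : Integrable Ibl := by
    rw [hIbl]; exact integrable_prodBlock_integrand hH hσ hE hT hpack hτ' hc₁ hφc w hband
  have hIcl_int : Integrable Icl := by
    rw [hIcl]; exact integrable_of_continuous_T3 (continuous_prodCl_integrand hσ hE hT hpack hτ')
  have hcompat' : ∀ (x : T3) (W : State), Torus.timeDerivWithin (Ico 0 T) (Lcl σ ρ θ u) τ x W +
      ∑ j, Torus.partialDeriv j (Lcl σ ρ θ u τ) x (fderiv ℝ (eulerFlux σ j) (Ucl ρ θ u τ x) W) = 0 :=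
    fun x W => hcompat τ hτ' x W
  have hpt : ∀ x, Ibl x - Icl x =
      ∑ j, Torus.partialDeriv j (Lcl σ ρ θ u τ) x (fluxRem σ j (bU φ w x) (Ucl ρ θ u τ x)) := by
    intro x
    rw [hIbl, hIcl]
    exact engine_compat σ (Torus.timeDerivWithin (Ico 0 T) (Lcl σ ρ θ u) τ x)
      (fun j => Torus.partialDeriv j (Lcl σ ρ θ u τ) x) (Ucl ρ θ u τ x) (bU φ w x) (hcompat' x)
  -- the hot blocks and the hot integrand
  obtain ⟨Hf, hHf⟩ : ∃ Hf : T3 → ℝ, Hf = fun x =>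
      bρ φ w x + ‖bm φ w x‖ + bE φ w x + bE φ w x * Real.sqrt (bE φ w x / bρ φ w x) := ⟨_, rfl⟩
  have hHc : Continuous Hf := by
    rw [hHf]; exact ((hρc.add hmc.norm).add hEc).add (hEc.mul (hEc.div hρc hρ0).sqrt)
  have hhotm : MeasurableSet {x | M * bρ φ w x < bE φ w x} :=
    measurableSet_lt (continuous_const.mul hρc).measurable hEc.measurable
  have hhotI : ∫ x in {x | M * bρ φ w x < bE φ w x}, Hf x ≤
      Ch * Real.sqrt M * Real.exp (-(lam * M / 4)) *
        ∫ y, Real.exp (lam * ‖y.2‖ ^ 2) ∂(empiricalMeasure w) := by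
    rw [hHf]; exact hhot n φ hφc hφ0 hφ1 w (fun x => (hband x).1) M hM
  -- pointwise bound of the remainders: relative-flux bound off the hot blocks, growth bound on them
  have hRle : ∀ x j, ‖fluxRem σ j (bU φ w x) (Ucl ρ θ u τ x)‖ ≤
      Cr * Real.sqrt M * relEnt σ (bU φ w x) (Ucl ρ θ u τ x) +
        Cr * {x | M * bρ φ w x < bE φ w x}.indicator Hf x := by
    intro x j
    by_cases hx : x ∈ {x | M * bρ φ w x < bE φ w x}
    · rw [indicator_of_mem hx]
      have h : ‖fluxRem σ j (bU φ w x) (Ucl ρ θ u τ x)‖ ≤ Cr * Hf x := by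
        rw [hHf]
        exact hrelB _ (hmemK τ hτ x) (bU φ w x) (hband x).1 (hband x).2 (hkin x).le j
      have h0 : 0 ≤ Cr * Real.sqrt M * relEnt σ (bU φ w x) (Ucl ρ θ u τ x) := by
        have := hrel0 x; positivity
      linarith
    · rw [indicator_of_notMem hx, mul_zero, add_zero]
      have hEM : bE φ w x ≤ M * bρ φ w x := not_lt.1 hx
      exact hrelA M hM _ (hmemK τ hτ x) (bU φ w x) (hband x).1 (hband x).2 (hkin x) hEM j
  have hsum : ∀ x, Icl x - Ibl x ≤
      3 * Lb * Cr * Real.sqrt M * relEnt σ (bU φ w x) (Ucl ρ θ u τ x) +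
        3 * Lb * Cr * {x | M * bρ φ w x < bE φ w x}.indicator Hf x := by
    intro x
    have h1 : Icl x - Ibl x =
        -∑ j, Torus.partialDeriv j (Lcl σ ρ θ u τ) x (fluxRem σ j (bU φ w x) (Ucl ρ θ u τ x)) := by
      linarith [hpt x]
    rw [h1, ← Finset.sum_neg_distrib]
    have h2 : ∀ j, -(Torus.partialDeriv j (Lcl σ ρ θ u τ) x (fluxRem σ j (bU φ w x) (Ucl ρ θ u τ x))) ≤
        Lb * (Cr * Real.sqrt M * relEnt σ (bU φ w x) (Ucl ρ θ u τ x) +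
          Cr * {x | M * bρ φ w x < bE φ w x}.indicator Hf x) := fun j =>
      calc -(Torus.partialDeriv j (Lcl σ ρ θ u τ) x (fluxRem σ j (bU φ w x) (Ucl ρ θ u τ x)))
          ≤ |Torus.partialDeriv j (Lcl σ ρ θ u τ) x (fluxRem σ j (bU φ w x) (Ucl ρ θ u τ x))| :=
            neg_le_abs _
        _ = ‖Torus.partialDeriv j (Lcl σ ρ θ u τ) x (fluxRem σ j (bU φ w x) (Ucl ρ θ u τ x))‖ :=
            (Real.norm_eq_abs _).symm
        _ ≤ ‖Torus.partialDeriv j (Lcl σ ρ θ u τ) x‖ * ‖fluxRem σ j (bU φ w x) (Ucl ρ θ u τ x)‖ :=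
            ContinuousLinearMap.le_opNorm _ _
        _ ≤ Lb * (Cr * Real.sqrt M * relEnt σ (bU φ w x) (Ucl ρ θ u τ x) +
              Cr * {x | M * bρ φ w x < bE φ w x}.indicator Hf x) :=
            mul_le_mul (hLe j τ hτ x) (hRle x j) (norm_nonneg _) hLb0
    calc ∑ j, -(Torus.partialDeriv j (Lcl σ ρ θ u τ) x (fluxRem σ j (bU φ w x) (Ucl ρ θ u τ x)))
        ≤ ∑ _j : Fin 3, Lb * (Cr * Real.sqrt M * relEnt σ (bU φ w x) (Ucl ρ θ u τ x) +
            Cr * {x | M * bρ φ w x < bE φ w x}.indicator Hf x) :=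
          Finset.sum_le_sum fun j _ => h2 j
      _ = 3 * Lb * Cr * Real.sqrt M * relEnt σ (bU φ w x) (Ucl ρ θ u τ x) +
            3 * Lb * Cr * {x | M * bρ φ w x < bE φ w x}.indicator Hf x := by
          rw [Finset.sum_const, Finset.card_univ, Fintype.card_fin, nsmul_eq_mul]
          push_cast
          ring
  -- integrate
  have hrelint : Integrable (fun x => relEnt σ (bU φ w x) (Ucl ρ θ u τ x)) :=
    integrable_of_continuous_T3 hrel
  have hHint : Integrable Hf := integrable_of_continuous_T3 hHc
  have hbound_int : Integrable (fun x =>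
      3 * Lb * Cr * Real.sqrt M * relEnt σ (bU φ w x) (Ucl ρ θ u τ x) +
        3 * Lb * Cr * {x | M * bρ φ w x < bE φ w x}.indicator Hf x) :=
    (hrelint.const_mul _).add ((hHint.indicator hhotm).const_mul _)
  have hdiff : prodCl σ T ρ θ u τ - prodBlock σ T ρ θ u φ τ w = ∫ x, (Icl x - Ibl x) := by
    rw [integral_sub hIcl_int hIbl_int, hIcl, hIbl]
    simp only [prodCl, prodBlock]
  have hI1 : ∫ x, (Icl x - Ibl x) ≤
      ∫ x, (3 * Lb * Cr * Real.sqrt M * relEnt σ (bU φ w x) (Ucl ρ θ u τ x) +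
        3 * Lb * Cr * {x | M * bρ φ w x < bE φ w x}.indicator Hf x) :=
    integral_mono (hIcl_int.sub hIbl_int) hbound_int hsum
  have hI2 : ∫ x, (3 * Lb * Cr * Real.sqrt M * relEnt σ (bU φ w x) (Ucl ρ θ u τ x) +
        3 * Lb * Cr * {x | M * bρ φ w x < bE φ w x}.indicator Hf x) =
      3 * Lb * Cr * Real.sqrt M * (∫ x, relEnt σ (bU φ w x) (Ucl ρ θ u τ x)) +
        3 * Lb * Cr * ∫ x in {x | M * bρ φ w x < bE φ w x}, Hf x := by
    rw [integral_add (hrelint.const_mul _) ((hHint.indicator hhotm).const_mul _), integral_const_mul,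
      integral_const_mul, integral_indicator hhotm]
  have hX0 : 0 ≤ ∫ x, relEnt σ (bU φ w x) (Ucl ρ θ u τ x) := integral_nonneg hrel0
  have hI0 : 0 ≤ ∫ y, Real.exp (lam * ‖y.2‖ ^ 2) ∂(empiricalMeasure w) :=
    integral_nonneg fun _ => (Real.exp_pos _).le
  calc prodCl σ T ρ θ u τ - prodBlock σ T ρ θ u φ τ w = ∫ x, (Icl x - Ibl x) := hdiff
    _ ≤ 3 * Lb * Cr * Real.sqrt M * (∫ x, relEnt σ (bU φ w x) (Ucl ρ θ u τ x)) +
          3 * Lb * Cr * ∫ x in {x | M * bρ φ w x < bE φ w x}, Hf x := hI1.trans_eq hI2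
    _ ≤ 3 * Lb * Cr * (1 + Ch) * Real.sqrt M * (∫ x, relEnt σ (bU φ w x) (Ucl ρ θ u τ x)) +
          3 * Lb * Cr * (1 + Ch) * Real.sqrt M * Real.exp (-(lam * M / 4)) *
            ∫ y, Real.exp (lam * ‖y.2‖ ^ 2) ∂(empiricalMeasure w) :=
        final_arith hLb0 hCr.le hCh.le (Real.sqrt_nonneg _) (Real.exp_pos _).le hI0 hX0 hhotI

end Barycentric

end Summit.AtomisticToContinuum.HydrodynamicLimit.Theorems.MacroClosureLine

end
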